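import Literature.MathematicalPhysics.QuantumLattice.HubbardFermiSectorGeometry
import Mathlib.Analysis.SpecialFunctions.Trigonometric.ArctanDeriv
import HarnessLib

/-!
# The Gauss map of the Hubbard Fermi curve: the normal angle `α(θ)` is bi-Lipschitz
(Lemma 7.1 of Benfatto–Giuliani–Mastropietro 2003)

Topic `Literature/MathematicalPhysics/QuantumLattice`; continues `HubbardFermiCurvature.lean` and
`HubbardFermiSectorGeometry.lean` (polar Fermi radius `u = fermiRadius μ`, `-4 < μ < -2 - √2`;
`u' = fermiRadiusDeriv`, `u'' = fermiRadiusDeriv2`; unit normal `fermiNormal = (y', -x')/s'`,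
`s' = fermiSpeed = √(u² + u'²)`; curvature `fermiCurvature` pinched between positive constants).

BGM 2003, §7.1, Lemma 7.1 (p. 26 of the arXiv text): "The angle `α(θ, e)` between `n(θ, e)` and
`e_r(0)` is a monotone increasing function of `θ`, such that, if `‖θ₁ - θ₂‖` denotes the distance on
`𝕋¹`, `c₁‖θ₂ - θ₁‖ ≤ ‖α(θ₂,e) - α(θ₁,e)‖ ≤ c₂‖θ₂ - θ₁‖` (A1.9); moreover `α(θ+π,e) - α(θ,e) = π`."
(BGM 2006, App. A3 re-prove it for `C²` curves with `α = arcsin{(1/s')[u sin θ - u' cos θ]}` and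
`|α'| = s'/r`.) This is the input of the parallelogram lemma and of the sector counting lemma
(BGM 2003 §7.3–7.4; BGM 2006 Lemma A3.1).

Because the curve is star-shaped with `n·e_r = u/s' > 0`, the normal angle has a canonical smooth
real lift, which we take as the DEFINITION: `α(θ) = θ - arctan(u'(θ)/u(θ))` (`normalAngle`). PROVED:

* `cos_normalAngle`, `sin_normalAngle` — `n(θ) = (cos α(θ), sin α(θ))` (so `α` is the angle of
  the outgoing normal with `e_r(0) = (1, 0)`);
* `hasDerivAt_normalAngle` — `α' = (u² + 2u'² - u u'')/(u² + u'²) = κ · s'` (turning rate =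
  curvature × speed; BGM's `|α'| = s'/r`), `normalAngleDeriv_pos`;
* `exists_normalAngleDeriv_bounds` — `0 < a₁ ≤ α'(θ) ≤ a₂` uniformly (curvature and speed bounds);
* **Lemma 7.1 / (A1.9)** (`normalAngle_bilipschitz`): `a₁|θ₂ - θ₁| ≤ |α(θ₂) - α(θ₁)| ≤ a₂|θ₂ - θ₁|`
  for all real `θ₁, θ₂`, and `strictMono_normalAngle`; the torus-distance form follows since
* `normalAngle_add_pi` — `α(θ + π) = α(θ) + π` (from `u(θ + π) = u(θ)`), together with
  `fermiRadiusDeriv_add_pi` (`u'(θ+π) = u'(θ)`).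

Everything is PROVED; the definitions (`normalAngle`, `normalAngleDeriv`) have bodies. [folklore]
computations on the explicit dispersion.

## Sources

* G. Benfatto, A. Giuliani, V. Mastropietro, Ann. Henri Poincaré 4 (2003) 137–193, §7.1
  Lemma 7.1, (A1.9)–(A1.10) (arXiv:cond-mat/0207210 p. 26). [BenfattoGiulianiMastropietro2003]
* G. Benfatto, A. Giuliani, V. Mastropietro, Ann. Henri Poincaré 7 (2006) 809–898, App. A3
  (proof of Lemma 7.1 for `C²` Fermi curves; arXiv:cond-mat/0507686 p. 37). [BenfattoGiulianiMastropietro2006]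
-/

noncomputable section

open Real Set Filter
open scoped Topology

namespace Literature.MathematicalPhysics.QuantumLattice

section Range

variable {μ : ℝ} (hμ₁ : -4 < μ) (hμ₂ : μ < -2 - Real.sqrt 2)
include hμ₁ hμ₂

/-! ### The normal angle and its trigonometry -/

omit hμ₁ hμ₂ in
/-- **The normal angle** `α(θ) = θ - arctan(u'(θ)/u(θ))`: the canonical smooth lift of the angle of
the outgoing unit normal `n(θ)` with the `x`-axis (BGM 2003 Lemma 7.1; `n·e_r = u/s' > 0` keeps the
correction in `(-π/2, π/2)`). [cite: BenfattoGiulianiMastropietro2003, §7.1 Lemma 7.1] -/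
def normalAngle (μ θ : ℝ) : ℝ := θ - Real.arctan (fermiRadiusDeriv μ θ / fermiRadius μ θ)

/-- `s' = u √(1 + (u'/u)²)`. [folklore] -/
theorem fermiSpeed_eq_mul_sqrt (θ : ℝ) :
    fermiSpeed μ θ = fermiRadius μ θ * Real.sqrt (1 + (fermiRadiusDeriv μ θ / fermiRadius μ θ) ^ 2) := by
  have hu := fermiRadius_pos hμ₁ hμ₂ θ
  rw [fermiSpeed, show fermiRadius μ θ * Real.sqrt (1 + (fermiRadiusDeriv μ θ / fermiRadius μ θ) ^ 2) =
      Real.sqrt (fermiRadius μ θ ^ 2 * (1 + (fermiRadiusDeriv μ θ / fermiRadius μ θ) ^ 2)) by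
    rw [Real.sqrt_mul (sq_nonneg _), Real.sqrt_sq hu.le]]
  congr 1
  field_simp

/-- **`cos α = n₀ = y'/s'`**. [cite: BenfattoGiulianiMastropietro2003, §7.1 Lemma 7.1] -/
theorem cos_normalAngle (θ : ℝ) : Real.cos (normalAngle μ θ) = fermiNormal μ θ 0 := by
  have hu := fermiRadius_pos hμ₁ hμ₂ θ
  have hs := fermiSpeed_pos hμ₁ hμ₂ θ
  set q := fermiRadiusDeriv μ θ / fermiRadius μ θ with hq
  have hsq : 0 < Real.sqrt (1 + q ^ 2) := Real.sqrt_pos.2 (by positivity)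
  rw [normalAngle, Real.cos_sub, Real.cos_arctan, Real.sin_arctan]
  simp only [fermiNormal, Pi.smul_apply, smul_eq_mul, Matrix.cons_val_zero, fermiVY]
  rw [fermiSpeed_eq_mul_sqrt hμ₁ hμ₂, ← hq]
  field_simp
  rw [hq]
  field_simp
  ring

/-- **`sin α = n₁ = -x'/s'`**. [cite: BenfattoGiulianiMastropietro2003, §7.1 Lemma 7.1] -/
theorem sin_normalAngle (θ : ℝ) : Real.sin (normalAngle μ θ) = fermiNormal μ θ 1 := by
  have hu := fermiRadius_pos hμ₁ hμ₂ θ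
  have hs := fermiSpeed_pos hμ₁ hμ₂ θ
  set q := fermiRadiusDeriv μ θ / fermiRadius μ θ with hq
  have hsq : 0 < Real.sqrt (1 + q ^ 2) := Real.sqrt_pos.2 (by positivity)
  rw [normalAngle, Real.sin_sub, Real.cos_arctan, Real.sin_arctan]
  simp only [fermiNormal, Pi.smul_apply, smul_eq_mul, Matrix.cons_val_one, Matrix.cons_val_zero, fermiVX]
  rw [fermiSpeed_eq_mul_sqrt hμ₁ hμ₂, ← hq]
  field_simp
  rw [hq]
  field_simp
  ring

/-! ### The turning rate `α' = κ s'` -/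

omit hμ₁ hμ₂ in
/-- The derivative of the normal angle: `α' = (u² + 2u'² - u u'')/(u² + u'²)`. [folklore] -/
def normalAngleDeriv (μ θ : ℝ) : ℝ :=
  (fermiRadius μ θ ^ 2 + 2 * fermiRadiusDeriv μ θ ^ 2 - fermiRadius μ θ * fermiRadiusDeriv2 μ θ) /
    (fermiRadius μ θ ^ 2 + fermiRadiusDeriv μ θ ^ 2)

/-- **`α` is differentiable with `α' = (u² + 2u'² - u u'')/(u² + u'²)`** (chain rule through
`arctan`). [cite: BenfattoGiulianiMastropietro2003, §7.1 Lemma 7.1] -/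
theorem hasDerivAt_normalAngle (θ : ℝ) : HasDerivAt (normalAngle μ) (normalAngleDeriv μ θ) θ := by
  have hu := fermiRadius_pos hμ₁ hμ₂ θ
  have hq : HasDerivAt (fun ϑ => fermiRadiusDeriv μ ϑ / fermiRadius μ ϑ)
      ((fermiRadiusDeriv2 μ θ * fermiRadius μ θ - fermiRadiusDeriv μ θ * fermiRadiusDeriv μ θ) /
        fermiRadius μ θ ^ 2) θ :=
    (hasDerivAt_fermiRadiusDeriv hμ₁ hμ₂ θ).div (hasDerivAt_fermiRadius hμ₁ hμ₂ θ) hu.ne'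
  have h := (hasDerivAt_id θ).sub hq.arctan
  refine h.congr_deriv ?_
  rw [normalAngleDeriv]
  have hs2 : fermiRadius μ θ ^ 2 + fermiRadiusDeriv μ θ ^ 2 ≠ 0 := by positivity
  field_simp
  ring

/-- **`α' = κ · s'`** (turning rate = curvature × speed; BGM: `|α'| = s'/r`). [cite: BenfattoGiulianiMastropietro2003, §7.1 Lemma 7.1] -/
theorem normalAngleDeriv_eq_curvature_mul_speed (θ : ℝ) :
    normalAngleDeriv μ θ = fermiCurvature μ θ * fermiSpeed μ θ := by
  have hs := fermiSpeed_pos hμ₁ hμ₂ θ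
  have hs2 : 0 < fermiRadius μ θ ^ 2 + fermiRadiusDeriv μ θ ^ 2 := by
    have := fermiRadius_pos hμ₁ hμ₂ θ; positivity
  rw [normalAngleDeriv, fermiCurvature, cross_eq_polar, fermiSpeed]
  have hsq : Real.sqrt (fermiRadius μ θ ^ 2 + fermiRadiusDeriv μ θ ^ 2) ^ 2 =
      fermiRadius μ θ ^ 2 + fermiRadiusDeriv μ θ ^ 2 := Real.sq_sqrt hs2.le
  have hsqrt : 0 < Real.sqrt (fermiRadius μ θ ^ 2 + fermiRadiusDeriv μ θ ^ 2) := Real.sqrt_pos.2 hs2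
  field_simp

/-- `α' > 0`: the normal turns counterclockwise, `α` is increasing. [cite: BenfattoGiulianiMastropietro2003, §7.1 Lemma 7.1] -/
theorem normalAngleDeriv_pos (θ : ℝ) : 0 < normalAngleDeriv μ θ := by
  rw [normalAngleDeriv_eq_curvature_mul_speed hμ₁ hμ₂]
  exact mul_pos (fermiCurvature_pos hμ₁ hμ₂ θ) (fermiSpeed_pos hμ₁ hμ₂ θ)

/-- `s' ≤ √K`. [folklore] -/
theorem fermiSpeed_le (θ : ℝ) : fermiSpeed μ θ ≤ Real.sqrt (π ^ 2 / 8 + (4 * π ^ 3 / (μ + 4)) ^ 2) :=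
  Real.sqrt_le_sqrt (fermiSpeedSq_le hμ₁ hμ₂ θ)

/-- **Uniform two-sided bounds on the turning rate**: `0 < a₁ ≤ α'(θ) ≤ a₂` for all `θ`. [cite: BenfattoGiulianiMastropietro2003, §7.1 Lemma 7.1] -/
theorem exists_normalAngleDeriv_bounds :
    ∃ a₁ a₂ : ℝ, 0 < a₁ ∧ a₁ ≤ a₂ ∧ ∀ θ : ℝ, a₁ ≤ normalAngleDeriv μ θ ∧ normalAngleDeriv μ θ ≤ a₂ := by
  obtain ⟨c₁, c₂, hc₁, hc₁₂, hκ⟩ := exists_fermiCurvature_bounds hμ₁ hμ₂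
  have hμ4 : 0 < μ + 4 := by linarith
  refine ⟨c₁ * Real.sqrt (μ + 4), c₂ * Real.sqrt (π ^ 2 / 8 + (4 * π ^ 3 / (μ + 4)) ^ 2),
    by positivity, ?_, fun θ => ?_⟩
  · have h := (hκ 0)
    have hs1 := sqrt_le_fermiSpeed hμ₁ hμ₂ 0
    have hs2 := fermiSpeed_le hμ₁ hμ₂ 0
    have : c₁ * Real.sqrt (μ + 4) ≤ c₂ * fermiSpeed μ 0 :=
      mul_le_mul hc₁₂ hs1 (Real.sqrt_nonneg _) (hc₁.le.trans hc₁₂)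
    exact this.trans (mul_le_mul_of_nonneg_left hs2 (hc₁.le.trans hc₁₂))
  · rw [normalAngleDeriv_eq_curvature_mul_speed hμ₁ hμ₂]
    have h := hκ θ
    exact ⟨mul_le_mul h.1 (sqrt_le_fermiSpeed hμ₁ hμ₂ θ) (Real.sqrt_nonneg _) (hc₁.le.trans h.1),
      mul_le_mul h.2 (fermiSpeed_le hμ₁ hμ₂ θ) (fermiSpeed_pos hμ₁ hμ₂ θ).le (hc₁.le.trans (h.1.trans h.2))⟩

/-! ### Lemma 7.1: `α` is strictly increasing and bi-Lipschitz -/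

/-- `α` is differentiable everywhere. [folklore] -/
theorem differentiable_normalAngle : Differentiable ℝ (normalAngle μ) :=
  fun θ => (hasDerivAt_normalAngle hμ₁ hμ₂ θ).differentiableAt

/-- `deriv α = normalAngleDeriv`. [folklore] -/
theorem deriv_normalAngle (θ : ℝ) : deriv (normalAngle μ) θ = normalAngleDeriv μ θ :=
  (hasDerivAt_normalAngle hμ₁ hμ₂ θ).deriv

/-- **`α` is strictly increasing** ("a monotone increasing function of `θ`"). [cite: BenfattoGiulianiMastropietro2003, §7.1 Lemma 7.1] -/
theorem strictMono_normalAngle : StrictMono (normalAngle μ) :=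
  strictMono_of_deriv_pos fun θ => by
    rw [deriv_normalAngle hμ₁ hμ₂]; exact normalAngleDeriv_pos hμ₁ hμ₂ θ

/-- **Lemma 7.1 of BGM 2003 / (A1.9) for the Hubbard Fermi curve**: the normal angle is
bi-Lipschitz, `a₁ |θ₂ - θ₁| ≤ |α(θ₂) - α(θ₁)| ≤ a₂ |θ₂ - θ₁|` for all real `θ₁, θ₂`, with the
constants of `exists_normalAngleDeriv_bounds` (mean value theorem both ways). [cite: BenfattoGiulianiMastropietro2003, §7.1 Lemma 7.1 (A1.9)] -/
theorem normalAngle_bilipschitz :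
    ∃ a₁ a₂ : ℝ, 0 < a₁ ∧ a₁ ≤ a₂ ∧ ∀ θ₁ θ₂ : ℝ,
      a₁ * |θ₂ - θ₁| ≤ |normalAngle μ θ₂ - normalAngle μ θ₁| ∧
        |normalAngle μ θ₂ - normalAngle μ θ₁| ≤ a₂ * |θ₂ - θ₁| := by
  obtain ⟨a₁, a₂, ha₁, ha₁₂, hb⟩ := exists_normalAngleDeriv_bounds hμ₁ hμ₂
  refine ⟨a₁, a₂, ha₁, ha₁₂, fun θ₁ θ₂ => ⟨?_, ?_⟩⟩
  · -- lower bound: monotone mean value theorem on the ordered pair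
    have hmvt : ∀ x y : ℝ, x ≤ y → a₁ * (y - x) ≤ normalAngle μ y - normalAngle μ x := by
      intro x y hxy
      refine (convex_univ (𝕜 := ℝ) (E := ℝ)).mul_sub_le_image_sub_of_le_deriv
        (differentiable_normalAngle hμ₁ hμ₂).continuous.continuousOn
        ((differentiable_normalAngle hμ₁ hμ₂).differentiableOn.mono interior_subset)
        (fun t _ => ?_) x (mem_univ x) y (mem_univ y) hxy
      rw [deriv_normalAngle hμ₁ hμ₂]; exact (hb t).1
    rcases le_total θ₁ θ₂ with h | h
    · have := hmvt θ₁ θ₂ h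
      rw [abs_of_nonneg (sub_nonneg.2 h), abs_of_nonneg (by nlinarith [ha₁])]
      exact this
    · have := hmvt θ₂ θ₁ h
      rw [abs_of_nonpos (sub_nonpos.2 h), abs_of_nonpos (by nlinarith [ha₁])]
      linarith
  · -- upper bound: Lipschitz mean value theorem
    have h := (convex_univ (𝕜 := ℝ) (E := ℝ)).norm_image_sub_le_of_norm_hasDerivWithin_le
      (f := normalAngle μ) (f' := normalAngleDeriv μ)
      (fun t _ => (hasDerivAt_normalAngle hμ₁ hμ₂ t).hasDerivWithinAt)
      (fun t _ => by
        rw [Real.norm_eq_abs, abs_of_pos (normalAngleDeriv_pos hμ₁ hμ₂ t)]; exact (hb t).2)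
      (mem_univ θ₁) (mem_univ θ₂)
    rwa [Real.norm_eq_abs, Real.norm_eq_abs] at h

/-! ### The half-turn symmetry `α(θ + π) = α(θ) + π` -/

/-- `u'(θ + π) = u'(θ)` (from `u(θ + π) = u(θ)`). [folklore] -/
theorem fermiRadiusDeriv_add_pi (θ : ℝ) : fermiRadiusDeriv μ (θ + π) = fermiRadiusDeriv μ θ := by
  have hfun : (fun ϑ => fermiRadius μ (ϑ + π)) = fermiRadius μ :=
    funext fun ϑ => fermiRadius_add_pi hμ₁ hμ₂ ϑ
  have h1 : HasDerivAt (fun ϑ => fermiRadius μ (ϑ + π)) (fermiRadiusDeriv μ (θ + π)) θ :=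
    (hasDerivAt_fermiRadius hμ₁ hμ₂ (θ + π)).comp_add_const θ π
  rw [hfun] at h1
  exact h1.unique (hasDerivAt_fermiRadius hμ₁ hμ₂ θ)

/-- **`α(θ + π) = α(θ) + π`** (the symmetric curve's normal turns by `π` over half a period). [cite: BenfattoGiulianiMastropietro2003, §7.1 Lemma 7.1] -/
theorem normalAngle_add_pi (θ : ℝ) : normalAngle μ (θ + π) = normalAngle μ θ + π := by
  rw [normalAngle, normalAngle, fermiRadius_add_pi hμ₁ hμ₂, fermiRadiusDeriv_add_pi hμ₁ hμ₂]
  ring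

end Range

end Literature.MathematicalPhysics.QuantumLattice

end
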